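import Literature.AnabelianGeometry.SemiGraphs.BranchActionKernelTransport

/-!
# The obstructed configuration: coverings trivial over the killed branches are trivial at the vertex

Mochizuki, *Semi-graphs of anabelioids*, Publ. RIMS **42** (2006), Remark 2.10.1 p. 32 ("a precise
description of the condition on edges … necessary to carry out such an argument [i.e., the analogue
for edges of the notion of an 'elevated vertex'] would be rather technical")
[cite: MochizukiSemiAnbd2006, Rem. 2.10.1 p.32].  This proof-only file (cell abc-iut, layer L3, row
F-1477, seat abc-iut-L3-t12) records the kernel form of WHY the hypothesis of
`IsOfSurfaceType.exists_bObj_trivial_nontrivial` (`SurfaceTypeEdgeSeparation.lean`) is necessary: at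
a vertex `v` in the OBSTRUCTED position for a set `Zb` of branches — every open normal subgroup of
`Π_v` containing the branch groups of `Zb` is all of `Π_v` (second disjunct of
`IsOfSurfaceType.exists_open_normal_mixed_or_obstructed`; e.g. a genus-`0` vertex with three cusps two
of which are the branches of a loop) — EVERY object `A ∈ B(𝒢)` that is trivial over the edges of the
branches in `Zb` has `Π_v` acting trivially on `F(S_v)`, hence is trivial over EVERY edge meeting `v`
(`edge_trivial_of_obstructed`): no finite étale covering separates the third edge from the loop.
The argument is the kernel `U_A = Ker(Π_v ↷ F(S_v))` (open normal, `BranchActionKernelTransport`) and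
the branch/edge dictionary `BranchActionOnFibre` (K1/K2).  Valid for ANY semi-graph of anabelioids.
No statement here takes a side on any disputed claim; nothing about [IUTchIII] Cor. 3.12.
-/

namespace Literature.AnabelianGeometry.SemiGraphs

open CategoryTheory CategoryTheory.PreGaloisCategory
open Literature.AnabelianGeometry.Anabelioids
open Topology

universe v₁ u₁ u

namespace SemiGraphOfAnabelioids

variable {𝒢 : SemiGraphOfAnabelioids.{v₁, u₁, u}}

/-- **In the obstructed position, triviality over the killed branches spreads to the whole vertex.**
Let `v` be a vertex with basepoint `F`, `Zb` a set of branches at `v` such that every open normal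
subgroup of `Π_v = Aut F` containing the branch groups `Π_b` (`b ∈ Zb`, all basepoints and transports)
is `Π_v` itself, and `A ∈ B(𝒢)` an object over whose edges `e(b)`, `b ∈ Zb`, the groups `Π_{e(b)}`
act trivially.  Then `Π_v` fixes every point of `F(S_v)`.
[cite: MochizukiSemiAnbd2006, Rem. 2.10.1 p.32] -/
theorem smul_eq_self_of_obstructed {v : 𝒢.graph.Vertex} (F : 𝒢.V v ⥤ FintypeCat.{v₁})
    [FiberFunctor F] (Zb : Set (𝒢.graph.Star v))
    (hobs : ∀ W : Subgroup (Aut F), IsOpen (W : Set (Aut F)) → W.Normal →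
      (∀ b : 𝒢.graph.Star v, b ∈ Zb →
        ∀ (Fe : 𝒢.E (𝒢.graph.edgeOf b.1) ⥤ FintypeCat.{v₁}) [FiberFunctor Fe]
          (α : (𝒢.pull b.1 v b.2).pullback ⋙ Fe ≅ F), 𝒢.branchSubgroup F b.1 b.2 Fe α ≤ W) →
      W = ⊤)
    (A : 𝒢.BObj)
    (htriv : ∀ b : 𝒢.graph.Star v, b ∈ Zb →
      ∀ (Fe : 𝒢.E (𝒢.graph.edgeOf b.1) ⥤ FintypeCat.{v₁}) [FiberFunctor Fe]
        (σ : Aut Fe) (y : Fe.obj (A.T (𝒢.graph.edgeOf b.1))), σ • y = y)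
    (g : Aut F) (x : F.obj (A.S v)) : g • x = x := by
  -- the kernel of `Π_v ↷ F(S_v)` is open normal and contains the killed branch groups
  let U : Subgroup (Aut F) := (MulAction.toPermHom (Aut F) (F.obj (A.S v))).ker
  have hU : U = ⊤ := by
    refine hobs U (isOpen_ker_toPermHom F (A.S v)) inferInstance fun b hb Fe _ α => ?_
    intro g hg
    show MulAction.toPermHom (Aut F) (F.obj (A.S v)) g = 1
    ext x
    rw [MulAction.toPermHom_apply, MulAction.toPerm_apply, Equiv.Perm.coe_one, id_eq]
    exact branchSubgroup_smul_eq_self_of_edge_trivial A F b.1 b.2 Fe α (htriv b hb Fe) hg x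
  have hg : g ∈ U := by rw [hU]; exact Subgroup.mem_top g
  have hg' : MulAction.toPermHom (Aut F) (F.obj (A.S v)) g = 1 := hg
  have := congrArg (fun p : Equiv.Perm (F.obj (A.S v)) => p x) hg'
  simpa using this

/-- **Hence `A` is trivial over EVERY edge meeting `v`** (in particular over the "third edge" of a
genus-`0` vertex carrying a loop both of whose branch groups were killed): for every branch `c` at
`v` and every basepoint `F_e` of `𝒢_{e(c)}`, `Π_{e(c)} = Aut F_e` fixes `F_e(T_{e(c)})`.  This is
the necessity of the hypothesis of `IsOfSurfaceType.exists_bObj_trivial_nontrivial`.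
[cite: MochizukiSemiAnbd2006, Rem. 2.10.1 p.32] -/
theorem edge_trivial_of_obstructed {v : 𝒢.graph.Vertex} (F : 𝒢.V v ⥤ FintypeCat.{v₁})
    [FiberFunctor F] (Zb : Set (𝒢.graph.Star v))
    (hobs : ∀ W : Subgroup (Aut F), IsOpen (W : Set (Aut F)) → W.Normal →
      (∀ b : 𝒢.graph.Star v, b ∈ Zb →
        ∀ (Fe : 𝒢.E (𝒢.graph.edgeOf b.1) ⥤ FintypeCat.{v₁}) [FiberFunctor Fe]
          (α : (𝒢.pull b.1 v b.2).pullback ⋙ Fe ≅ F), 𝒢.branchSubgroup F b.1 b.2 Fe α ≤ W) →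
      W = ⊤)
    (A : 𝒢.BObj)
    (htriv : ∀ b : 𝒢.graph.Star v, b ∈ Zb →
      ∀ (Fe : 𝒢.E (𝒢.graph.edgeOf b.1) ⥤ FintypeCat.{v₁}) [FiberFunctor Fe]
        (σ : Aut Fe) (y : Fe.obj (A.T (𝒢.graph.edgeOf b.1))), σ • y = y)
    (c : 𝒢.graph.Star v) (Fe : 𝒢.E (𝒢.graph.edgeOf c.1) ⥤ FintypeCat.{v₁}) [FiberFunctor Fe]
    (σ : Aut Fe) (y : Fe.obj (A.T (𝒢.graph.edgeOf c.1))) : σ • y = y := by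
  by_contra hne
  -- a transport exists since both are fibre functors of `𝒢_v`
  haveI : FiberFunctor ((𝒢.pull c.1 v c.2).pullback ⋙ Fe) := fiberFunctor_comp_of_exact _ Fe
  obtain ⟨α⟩ := nonempty_iso_of_fiberFunctor ((𝒢.pull c.1 v c.2).pullback ⋙ Fe) F
  obtain ⟨g, -, x, hx⟩ :=
    exists_branchSubgroup_smul_ne_of_edge_nontrivial A F c.1 c.2 Fe α ⟨σ, y, hne⟩
  exact hx (smul_eq_self_of_obstructed F Zb hobs A htriv g x)

end SemiGraphOfAnabelioids

end Literature.AnabelianGeometry.SemiGraphs
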